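import Summits.QuantumFields.Balaban3D.Proofs.Thm2AC
import HarnessLib

/-!
# `AlphaInputsT3ACLoc59RowsOfGraphPair` — THE (D→) DOOR OF THE (R2′) RE-CUT: «(α) rows #14 `hact` + #15 `hG` (+ (25) for the activities) ⟹ the two (59)-localisation rows
# `hloc58` ∧ `hlocLow` in LQB's `LocalizationUpper`∕`LocalizationLower` shape» — the kernel certificate that the proposed re-cut of rows #14∕#15 LOSES NOTHING the lane uses
# (cell `ym3-torus`, ★★OWNER g35 word 2026-08-30 12:41Z «GO (D→)» on the LOCATE `LOCATE-R2prime-shape-check-cstp1g37.md` = 19936 evidence #60; seat `ym-line-cst-p1` g37, free hand;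
# `--supports stmt-QuantumFields-19936 --as helper`; CREDITS NOTHING)

THE POINT (LOCATE #60 §2–§3).  The only readers of rows #14∕#15 of `StepDataV3CoreAC` — `AlphaAdaptersAC.cumulant58_piecesAC` ∕ `cumulantLower_piecesAC` (C3∕C4) — extract from them exactly the
`hloc` hypotheses of ✓`Cumulant324.cumulant58_of_eq324` :128 ∕ ✓`cumulantLower_of_eq324` :153, which are LQB's ✓`B10Eq24Cumulant.FluctuationModel.LocalizationUpper` :647 ∕ `LocalizationLower` :653
at the lane's pieces.  This file proves THAT extraction as a standalone theorem with the re-cut row texts as conclusions: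

    hloc58  : ∀ h U, Σ_{n ∈ Icc 1 𝔠.nbar} (𝔖 k).cum h U n ∕ n! ≤ (piecesAC 𝔠.lane X 𝔖 k).PprU h U + (𝔠.C25·K₀(4·2³,2·3))·S.gk k·(piecesAC …).Zvol h + (𝔠.C25·K₀(4·2³,2·3)·e^{−𝔠.R₁})·(piecesAC …).rem
    hlocLow : ∀ U, (piecesAC …).PprU (Hist.triv S.P (k+1)) U − (𝔠.C25·K₀(4·2³,2·3)·e^{−𝔠.R₁})·(piecesAC …).rem ≤ Σ_{n ∈ Icc 1 𝔠.nbar} (𝔖 k).cum (Hist.triv S.P (k+1)) U n ∕ n!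

= [Balaban1985UV3] p.270 L30–34 «Terms with localization domains X having non-empty intersections with Ω_{k+1}ᶜ are estimated by O(g_k)|Z_k|.  Terms with domains X, which are not
contained in a cube of the size R(g_k)M₁, are estimated by O((Lᵏε)^{3+κ₀})|T₁^{(k)}|.  The remaining terms give the sum (59)» (upper, every history) and p.272 «The lower bound is proved in the same
way … Ω_{k+1} = T_η» (lower, trivial history, no `|Z_k|` term).  PROOF = ✓`Cumulant59.loc59_upper_of_bound25` ∕ `loc59_lower_of_bound25` (p5) at the AC pieces, fed exactly as
✓`LeavesCumAC.cumulant58_series_stdAC` feeds them inside C3: `hrep` = the identity `Σ cum∕n! = Σ_X act` from #15 `hG` ∘ #14 `hact` (px17 ✓(G3)), `h25` = (25) for the activities (a THEOREM of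
rows `chart` + `bound28`: ✓`Thm2AC.bound25_actAC_of_le`; displayed here as a letter), `hPprU` = the (59) sum (`rfl`, ✓`SeriesAC.seriesPiecesAC_PprU`), `hZ` = ✓`card_compl_ΩblkOf_le_ZVol`, `hlarge` =
✓`ScalesArithmetic.largeLoc_le_normRem`.
* §1 ★★ `hloc58_of_hact_hG` — the upper row; ★★ `hlocLow_of_hact_hG` — the lower row; ★★★ `loc59Rows_of_hact_hG` — both.
HONEST SCOPE: a door over landed carriers; (α) data rows 0∕23 unchanged; the localisation estimate itself ((23)–(25)+(59), GAPS G-IF-04∕G-B10-13) is NOT proved — it is the content of the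
hypotheses; nothing of (O‴χₛ), `HistoryTailL` (19936), EX, `YM3TorusSU2` (R3 — SU(2) YM₃ on T³, a RECORD rung: NOT d = 4, NOT infinite volume, NOT a mass gap, NOT Clay) is proved; the
Yang–Mills mass gap is NOT proved.

References: T. Bałaban, Commun. Math. Phys. **102** (1985) 255–275 [Balaban1985UV3] ((23)–(25) p.262, (58)–(59) p.270, p.272); J. Fröhlich et al. are not used.
-/

set_option autoImplicit false

noncomputable section

namespace Summit.QuantumFields.YangMills.Theorems.AlphaV3Loc59RowsOfGraphPair

open scoped BigOperators Nat
open MeasureTheory Metric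
open Literature.MathematicalPhysics.QuantumFieldTheory.Balaban1983to89
open Literature.MathematicalPhysics.QuantumFieldTheory.Balaban1983to89.B10
open Literature.MathematicalPhysics.QuantumFieldTheory.Balaban1983to89.B12TreeDecay (kappa₀ K₀ K₀_pos)
open Literature.MathematicalPhysics.QuantumFieldTheory.Balaban1983to89.TreeLengthTorus (tsys tcubeSys tdegreeLE tvolumeLeaf card_tcube TPt)
open Literature.MathematicalPhysics.QuantumFieldTheory.Balaban1985CMP102
open Literature.MathematicalPhysics.QuantumFieldTheory.Balaban1985CMP102.Setting
open Literature.MathematicalPhysics.QuantumFieldTheory.Balaban1985CMP102.Binders (GraphRep23AsCited)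
open Summit.QuantumFields.Balaban3D.Carriers
open Summit.QuantumFields.Balaban3D.Proofs
open Summit.QuantumFields.Balaban3D.Proofs.ScalesArithmetic (gk_pos gk_le_one largeLoc_le_normRem norm_rem_eq)
open Summit.QuantumFields.Balaban3D.Proofs.Primitives
open Summit.QuantumFields.Balaban3D.Proofs.TowerAC
open Summit.QuantumFields.Balaban3D.Proofs.SeriesAC
open Summit.QuantumFields.Balaban3D.Proofs.StandardAC
open Summit.QuantumFields.Balaban3D.Proofs.InputsAC
open Summit.QuantumFields.Balaban3D.Proofs.Inputs (nblk_cube_le_sites)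
open Summit.QuantumFields.Balaban3D.Proofs.GroupModelLieC (lieC)

variable {L : ℕ} {S : Scales L} {G : Type} [GaugeGroup G] [MeasurableSpace G] [HaarData G] (𝔊 : GroupModel G) (𝔠 : AlphaConsts L 𝔊.N)
  (X : ExternalInputsAC S G) (𝔖 : ∀ k, StepSeries S G ↥(lieC 𝔊) (nblkOf S 𝔠.lane.carrier k) k) (k : ℕ)

/-! ## §1 The two (59)-localisation rows from the graph pair + (25) -/

open Classical in
/-- ★★ **ROW `hloc58` (LQB `LocalizationUpper` AT THE LANE'S PIECES) FROM (α) ROWS #14 `hact` + #15 `hG` + (25)**: at every history `h` and coarse field `U`,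
`Σ_{n ≤ n̄} cum∕n! ≤ PprU + (C25·K₀(32,6))·g_k·|Z_k(h)| + (C25·K₀(32,6)·e^{−R₁})·rem` — the three sentences before (59), p.270 L30–34.  Proof: ✓`Cumulant59.loc59_upper_of_bound25` on LQB's torus cube
system with `hrep := (hG h).cum_eq_sum_activities ∘ hact`, the (59) sum by `rfl`, the `Z_k` block count and the large-domain arithmetic exactly as in ✓`LeavesCumAC.cumulant58_series_stdAC`.
[cite: Balaban1985UV3, (59) p.270 + (23)–(25) p.262] -/
theorem hloc58_of_hact_hG (hk : k + 1 ≤ S.K) {C₂₃ c M₁ δ₀ : ℝ}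
    (hact : ∀ h Y U, ((𝔖 k).Gt h).activities.act Y U = (𝔖 k).act h Y U)
    (hG : ∀ h, GraphRep23AsCited ((𝔖 k).Gt h) (fun U => ∑ n ∈ Finset.Icc 1 𝔠.nbar, (𝔖 k).cum h U n / (n ! : ℝ)) C₂₃ c M₁ δ₀)
    (h25 : ∀ h, Bound25Printed ⟨(tsys 3 (nblkOf S 𝔠.lane.carrier k)).Dom, GaugeField S.P (k + 1) G, (tsys 3 (nblkOf S 𝔠.lane.carrier k)).dj,
      (𝔖 k).act h⟩ (S.gk k) 𝔠.κ 𝔠.C25) :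
    ∀ (h : Hist S.P (k + 1)) (U : GaugeField S.P (k + 1) G),
      ∑ n ∈ Finset.Icc 1 𝔠.nbar, (𝔖 k).cum h U n / (n ! : ℝ)
        ≤ (piecesAC 𝔠.lane X 𝔖 k).PprU h U + (𝔠.C25 * K₀ (4 * 2 ^ 3) (2 * 3)) * S.gk k * (piecesAC 𝔠.lane X 𝔖 k).Zvol h
          + (𝔠.C25 * K₀ (4 * 2 ^ 3) (2 * 3) * Real.exp (-𝔠.R₁)) * (piecesAC 𝔠.lane X 𝔖 k).rem := by
  classical
  intro h U
  have hg : 0 < S.gk k := gk_pos S k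
  have hK₀ : 0 ≤ K₀ (4 * 2 ^ 3) (2 * 3) := (K₀_pos _ _).le
  have hR : 0 ≤ (X.toTowerBase 𝔠.lane.carrier).Rret k := by
    show 0 ≤ 𝔠.R₁ * rFun 𝔠.r₀ (S.gk k)
    exact mul_nonneg 𝔠.R₁_nonneg (VacuumAndBooking.rFun_nonneg 𝔠.r₀ (S.gk k) hg (gk_le_one S S.gK_le_one k (by omega)))
  have hZ : ∀ h', (((Finset.univ : Finset (tcubeSys 3 (nblkOf S 𝔠.lane.carrier k)).Cube) \
      ΩblkOf (P := S.P) 𝔠.lane.carrier.M₁ (rcolOf S 𝔠.lane.carrier) (nblkOf S 𝔠.lane.carrier k) h').card : ℝ)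
        ≤ (piecesAC 𝔠.lane X 𝔖 k).Zvol h' := fun h' =>
    (X.toTowerBase 𝔠.lane.carrier).seriesPiecesAC_hZ 𝔖 (piecesParamsOf S 𝔠.lane.carrier) k h'
  have hlarge : (𝔠.C25 * S.gk k * K₀ (4 * 2 ^ 3) (2 * 3) * (Fintype.card (tcubeSys 3 (nblkOf S 𝔠.lane.carrier k)).Cube : ℝ))
      * Real.exp (-(X.toTowerBase 𝔠.lane.carrier).Rret k) ≤
        (𝔠.C25 * K₀ (4 * 2 ^ 3) (2 * 3) * Real.exp (-𝔠.R₁)) * (piecesAC 𝔠.lane X 𝔖 k).rem := by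
    have hcard : (Fintype.card (tcubeSys 3 (nblkOf S 𝔠.lane.carrier k)).Cube : ℝ) = ((nblkOf S 𝔠.lane.carrier k : ℕ) : ℝ) ^ 3 := by
      rw [card_tcube]; push_cast; rfl
    have hblocks : ((nblkOf S 𝔠.lane.carrier k : ℕ) : ℝ) ^ 3 ≤ S.sites k := nblk_cube_le_sites 𝔠.lane k (by omega)
    have hκ3 : (0 : ℝ) ≤ 3 + 𝔠.lane.carrier.κ₀ := by show (0 : ℝ) ≤ 3 + 𝔠.κ₀; linarith [𝔠.κ₀_pos]
    have hR2 : 2 * (3 + 𝔠.lane.carrier.κ₀) ≤ 𝔠.R₁ := by show 2 * (3 + 𝔠.κ₀) ≤ 𝔠.R₁; linarith [𝔠.R₁_ge]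
    have hle := largeLoc_le_normRem S (r₀ := 𝔠.r₀) (R₁ := 𝔠.R₁) (κ₀ := 𝔠.lane.carrier.κ₀) (A := 𝔠.C25 * K₀ (4 * 2 ^ 3) (2 * 3))
      (vol := ((nblkOf S 𝔠.lane.carrier k : ℕ) : ℝ) ^ 3) k (by omega) 𝔠.one_le_r₀ hκ3 hR2
      (mul_nonneg 𝔠.C25_nonneg hK₀) (by positivity) hblocks
    have hrem : (piecesAC 𝔠.lane X 𝔖 k).rem = (S.gk k ^ 2) ^ (3 + 𝔠.lane.carrier.κ₀) * S.sites k := rfl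
    rw [hcard, hrem]
    calc 𝔠.C25 * S.gk k * K₀ (4 * 2 ^ 3) (2 * 3) * ((nblkOf S 𝔠.lane.carrier k : ℕ) : ℝ) ^ 3 * Real.exp (-(X.toTowerBase 𝔠.lane.carrier).Rret k)
        = 𝔠.C25 * K₀ (4 * 2 ^ 3) (2 * 3) * S.gk k * ((nblkOf S 𝔠.lane.carrier k : ℕ) : ℝ) ^ 3 * Real.exp (-(𝔠.R₁ * rFun 𝔠.r₀ (S.gk k))) := by
          show _ * Real.exp (-(𝔠.R₁ * rFun 𝔠.r₀ (S.gk k))) = _; ring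
      _ ≤ 𝔠.C25 * K₀ (4 * 2 ^ 3) (2 * 3) * Real.exp (-𝔠.R₁) * ((S.gk k ^ 2) ^ (3 + 𝔠.lane.carrier.κ₀) * S.sites k) := hle
  exact loc59_upper_of_bound25 (tcubeSys 3 (nblkOf S 𝔠.lane.carrier k)) (piecesAC 𝔠.lane X 𝔖 k)
    (tdegreeLE 3 _) (tvolumeLeaf 3 _) 𝔠.kappa_ge (𝔖 k).cum (𝔖 k).act
    (fun h' => ΩblkOf (P := S.P) 𝔠.lane.carrier.M₁ (rcolOf S 𝔠.lane.carrier) (nblkOf S 𝔠.lane.carrier k) h')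
    hR (mul_nonneg 𝔠.C25_nonneg hg.le) h25
    (fun h' U' => by rw [(hG h').cum_eq_sum_activities U']; exact Finset.sum_congr rfl fun Y _ => hact h' Y U')
    (fun h' U' => by rw [← sum_filter_and_eq]; rfl) hZ hlarge h U

open Classical in
/-- ★★ **ROW `hlocLow` (LQB `LocalizationLower` AT THE LANE'S PIECES) FROM (α) ROWS #14 + #15 + (25)**: at the trivial history (`Ω_{k+1} = T_η`, no `|Z_k|` term, p.272),
`PprU - (C25·K₀(32,6)·e^{−R₁})·rem ≤ Σ_{n ≤ n̄} cum∕n!`.  Proof: ✓`Cumulant59.loc59_lower_of_bound25`, same feeds. [cite: Balaban1985UV3, p.272 + (59) p.270] -/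
theorem hlocLow_of_hact_hG (hk : k + 1 ≤ S.K) {C₂₃ c M₁ δ₀ : ℝ}
    (hact : ∀ h Y U, ((𝔖 k).Gt h).activities.act Y U = (𝔖 k).act h Y U)
    (hG : ∀ h, GraphRep23AsCited ((𝔖 k).Gt h) (fun U => ∑ n ∈ Finset.Icc 1 𝔠.nbar, (𝔖 k).cum h U n / (n ! : ℝ)) C₂₃ c M₁ δ₀)
    (h25 : ∀ h, Bound25Printed ⟨(tsys 3 (nblkOf S 𝔠.lane.carrier k)).Dom, GaugeField S.P (k + 1) G, (tsys 3 (nblkOf S 𝔠.lane.carrier k)).dj,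
      (𝔖 k).act h⟩ (S.gk k) 𝔠.κ 𝔠.C25) :
    ∀ U : GaugeField S.P (k + 1) G,
      (piecesAC 𝔠.lane X 𝔖 k).PprU (Hist.triv S.P (k + 1)) U - (𝔠.C25 * K₀ (4 * 2 ^ 3) (2 * 3) * Real.exp (-𝔠.R₁)) * (piecesAC 𝔠.lane X 𝔖 k).rem
        ≤ ∑ n ∈ Finset.Icc 1 𝔠.nbar, (𝔖 k).cum (Hist.triv S.P (k + 1)) U n / (n ! : ℝ) := by
  classical
  intro U
  have hg : 0 < S.gk k := gk_pos S k
  have hK₀ : 0 ≤ K₀ (4 * 2 ^ 3) (2 * 3) := (K₀_pos _ _).le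
  have hR : 0 ≤ (X.toTowerBase 𝔠.lane.carrier).Rret k := by
    show 0 ≤ 𝔠.R₁ * rFun 𝔠.r₀ (S.gk k)
    exact mul_nonneg 𝔠.R₁_nonneg (VacuumAndBooking.rFun_nonneg 𝔠.r₀ (S.gk k) hg (gk_le_one S S.gK_le_one k (by omega)))
  have hZ : ∀ h', (((Finset.univ : Finset (tcubeSys 3 (nblkOf S 𝔠.lane.carrier k)).Cube) \
      ΩblkOf (P := S.P) 𝔠.lane.carrier.M₁ (rcolOf S 𝔠.lane.carrier) (nblkOf S 𝔠.lane.carrier k) h').card : ℝ)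
        ≤ (piecesAC 𝔠.lane X 𝔖 k).Zvol h' := fun h' =>
    (X.toTowerBase 𝔠.lane.carrier).seriesPiecesAC_hZ 𝔖 (piecesParamsOf S 𝔠.lane.carrier) k h'
  have hlarge : (𝔠.C25 * S.gk k * K₀ (4 * 2 ^ 3) (2 * 3) * (Fintype.card (tcubeSys 3 (nblkOf S 𝔠.lane.carrier k)).Cube : ℝ))
      * Real.exp (-(X.toTowerBase 𝔠.lane.carrier).Rret k) ≤
        (𝔠.C25 * K₀ (4 * 2 ^ 3) (2 * 3) * Real.exp (-𝔠.R₁)) * (piecesAC 𝔠.lane X 𝔖 k).rem := by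
    have hcard : (Fintype.card (tcubeSys 3 (nblkOf S 𝔠.lane.carrier k)).Cube : ℝ) = ((nblkOf S 𝔠.lane.carrier k : ℕ) : ℝ) ^ 3 := by
      rw [card_tcube]; push_cast; rfl
    have hblocks : ((nblkOf S 𝔠.lane.carrier k : ℕ) : ℝ) ^ 3 ≤ S.sites k := nblk_cube_le_sites 𝔠.lane k (by omega)
    have hκ3 : (0 : ℝ) ≤ 3 + 𝔠.lane.carrier.κ₀ := by show (0 : ℝ) ≤ 3 + 𝔠.κ₀; linarith [𝔠.κ₀_pos]
    have hR2 : 2 * (3 + 𝔠.lane.carrier.κ₀) ≤ 𝔠.R₁ := by show 2 * (3 + 𝔠.κ₀) ≤ 𝔠.R₁; linarith [𝔠.R₁_ge]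
    have hle := largeLoc_le_normRem S (r₀ := 𝔠.r₀) (R₁ := 𝔠.R₁) (κ₀ := 𝔠.lane.carrier.κ₀) (A := 𝔠.C25 * K₀ (4 * 2 ^ 3) (2 * 3))
      (vol := ((nblkOf S 𝔠.lane.carrier k : ℕ) : ℝ) ^ 3) k (by omega) 𝔠.one_le_r₀ hκ3 hR2
      (mul_nonneg 𝔠.C25_nonneg hK₀) (by positivity) hblocks
    have hrem : (piecesAC 𝔠.lane X 𝔖 k).rem = (S.gk k ^ 2) ^ (3 + 𝔠.lane.carrier.κ₀) * S.sites k := rfl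
    rw [hcard, hrem]
    calc 𝔠.C25 * S.gk k * K₀ (4 * 2 ^ 3) (2 * 3) * ((nblkOf S 𝔠.lane.carrier k : ℕ) : ℝ) ^ 3 * Real.exp (-(X.toTowerBase 𝔠.lane.carrier).Rret k)
        = 𝔠.C25 * K₀ (4 * 2 ^ 3) (2 * 3) * S.gk k * ((nblkOf S 𝔠.lane.carrier k : ℕ) : ℝ) ^ 3 * Real.exp (-(𝔠.R₁ * rFun 𝔠.r₀ (S.gk k))) := by
          show _ * Real.exp (-(𝔠.R₁ * rFun 𝔠.r₀ (S.gk k))) = _; ring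
      _ ≤ 𝔠.C25 * K₀ (4 * 2 ^ 3) (2 * 3) * Real.exp (-𝔠.R₁) * ((S.gk k ^ 2) ^ (3 + 𝔠.lane.carrier.κ₀) * S.sites k) := hle
  exact loc59_lower_of_bound25 (tcubeSys 3 (nblkOf S 𝔠.lane.carrier k)) (piecesAC 𝔠.lane X 𝔖 k)
    (tdegreeLE 3 _) (tvolumeLeaf 3 _) 𝔠.kappa_ge (𝔖 k).cum (𝔖 k).act
    (fun h' => ΩblkOf (P := S.P) 𝔠.lane.carrier.M₁ (rcolOf S 𝔠.lane.carrier) (nblkOf S 𝔠.lane.carrier k) h')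
    hR (mul_nonneg 𝔠.C25_nonneg hg.le) h25
    (fun h' U' => by rw [(hG h').cum_eq_sum_activities U']; exact Finset.sum_congr rfl fun Y _ => hact h' Y U')
    (fun h' U' => by rw [← sum_filter_and_eq]; rfl) hZ hlarge U

open Classical in
/-- ★★★ **BOTH (59)-LOCALISATION ROWS OF THE (R2′) RE-CUT FROM THE GRAPH PAIR + (25)** — rows #14∕#15 may be replaced by `hloc58` ∧ `hlocLow` without loss for the lane: everything C3∕C4 read
from the pair is here. [cite: Balaban1985UV3, (59) p.270 + p.272] -/
theorem loc59Rows_of_hact_hG (hk : k + 1 ≤ S.K) {C₂₃ c M₁ δ₀ : ℝ}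
    (hact : ∀ h Y U, ((𝔖 k).Gt h).activities.act Y U = (𝔖 k).act h Y U)
    (hG : ∀ h, GraphRep23AsCited ((𝔖 k).Gt h) (fun U => ∑ n ∈ Finset.Icc 1 𝔠.nbar, (𝔖 k).cum h U n / (n ! : ℝ)) C₂₃ c M₁ δ₀)
    (h25 : ∀ h, Bound25Printed ⟨(tsys 3 (nblkOf S 𝔠.lane.carrier k)).Dom, GaugeField S.P (k + 1) G, (tsys 3 (nblkOf S 𝔠.lane.carrier k)).dj,
      (𝔖 k).act h⟩ (S.gk k) 𝔠.κ 𝔠.C25) :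
    (∀ (h : Hist S.P (k + 1)) (U : GaugeField S.P (k + 1) G),
      ∑ n ∈ Finset.Icc 1 𝔠.nbar, (𝔖 k).cum h U n / (n ! : ℝ)
        ≤ (piecesAC 𝔠.lane X 𝔖 k).PprU h U + (𝔠.C25 * K₀ (4 * 2 ^ 3) (2 * 3)) * S.gk k * (piecesAC 𝔠.lane X 𝔖 k).Zvol h
          + (𝔠.C25 * K₀ (4 * 2 ^ 3) (2 * 3) * Real.exp (-𝔠.R₁)) * (piecesAC 𝔠.lane X 𝔖 k).rem) ∧
    (∀ U : GaugeField S.P (k + 1) G,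
      (piecesAC 𝔠.lane X 𝔖 k).PprU (Hist.triv S.P (k + 1)) U - (𝔠.C25 * K₀ (4 * 2 ^ 3) (2 * 3) * Real.exp (-𝔠.R₁)) * (piecesAC 𝔠.lane X 𝔖 k).rem
        ≤ ∑ n ∈ Finset.Icc 1 𝔠.nbar, (𝔖 k).cum (Hist.triv S.P (k + 1)) U n / (n ! : ℝ)) :=
  ⟨hloc58_of_hact_hG 𝔊 𝔠 X 𝔖 k hk hact hG h25, hlocLow_of_hact_hG 𝔊 𝔠 X 𝔖 k hk hact hG h25⟩

end Summit.QuantumFields.YangMills.Theorems.AlphaV3Loc59RowsOfGraphPair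

end
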